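import Mathlib.LinearAlgebra.Basis.VectorSpace
import Mathlib.MeasureTheory.Function.L2Space
import Mathlib.Probability.Moments.Variance
import Literature.MathematicalPhysics.KineticTheory.InfiniteChainObservables
import HarnessLib

/-!
# Stationary first-order perturbations of polynomial growth: the classes `𝓗_k(ℤ)`

Topic `Literature/MathematicalPhysics/KineticTheory`; definition request
`defn-StationaryPerturbationClass` (route `LiouvilleLadder` of `AtomisticToContinuum/FouriersLaw`,
items `PlaneLiouville` = stmt-AtomisticToContinuum-4427, `SlopeCurrentLaw` = stmt-4428; idea cards
`single-thermostat-rigidity`, `conservation-law-rigidity-local-ohm`).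

## The notion

For the infinite chain `P : OscillatorChain` on `ChainConfig = ℤ → ℝ × ℝ`, a reference measure `μ`
(intended: a DLR Gibbs state, `P.IsChainGibbsMeasure T μ`) and `k : ℕ`, a functional
`ν : (ChainConfig → ℝ) → ℝ` satisfies `P.IsStationaryPerturbation μ k ν` when (a) `ν` is `ℝ`-linear;
(b) FIRST-ORDER STATIONARITY `ν (𝒜f) = 0` for every local test function `f ∈ C₀¹`
(`IsLocalTestFunction`, `𝒜 = liouvilleZ P`) — the linearisation at `μ` of the generator form
`∫ 𝒜f dν = 0` of time invariance (Bernardin 2014 §1.1 Def. 1 footnote; McLennan's first-order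
steady ensembles, McLennan 1959, Maes–Netočný 2010); (c) GROWTH OF ORDER `k`: for every box length
`n` some `C_n` with `|ν (g ∘ boxRestrictAt a n)| ≤ C_n (1 + |a|)^k ‖g ∘ boxRestrictAt a n‖_{L²(μ)}`
for all `a : ℤ` and all `C¹` maps `g` with `g ∘ boxRestrictAt a n` square-integrable (the
polynomial-growth grading of Liouville theorems, Avellaneda–Lin 1987, for functionals on local
observables). `𝓗_k(ℤ) = {ν | P.IsStationaryPerturbation μ k ν}` is the submodule
`P.StationaryPerturbationClass μ k`. With `k = 1` the clauses are word for word the hypothesis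
block inlined three times in `PlaneLiouville` / `SlopeCurrentLaw` (`isStationaryPerturbation_one_iff`:
both items restate by `simp only [isStationaryPerturbation_one_iff, and_imp, and_assoc]`, checked in
a scratch file; Literature cannot import `Summits`); `k = 0` is the bounded class of the cards.

## Contents (all proved)

* `OscillatorChain.IsStationaryPerturbation` + `_iff / _one_iff / _zero_iff`; `toLinearMap`,
  `map_add / map_smul / map_zero / map_neg / map_sub`, `linear_of_linearMap`.
* Linear structure `zero / add / smul / neg / sub`, the submodule `StationaryPerturbationClass`,
  monotonicity in `k` (`mono`, `stationaryPerturbationClass_mono`).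
* `L²(μ)`-Lipschitz continuity on `C¹` functions of a box from (a)+(c): `abs_sub_le`.
* The spatial shift `τ` (`shift`; measurability, `shiftEquiv`, the change of variables under
  `IsShiftInvariant μ` and `IsLocalTestFunction.comp_shift` being those of
  `InfiniteChainObservables`): `measurePreserving_shift`, `boxRestrictAt_shift`,
  `𝒜(f ∘ τ) = (𝒜f) ∘ τ` as functions (`OscillatorChain.liouvilleZ_comp_shift`), and the closure
  `IsStationaryPerturbation.comp_shift` (`ν ↦ ν (· ∘ τ)`, constant `max C_n 0 · 2^k`), bundled as
  the linear map `stationaryPerturbationClassShift`.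
* Non-vacuity `OscillatorChain.exists_isStationaryPerturbation_integral`: for a probability measure
  `μ` with `IsTimeInvariant P μ`, a linear extension of `f ↦ ∫ f dμ` from `integrableSubmodule μ` to
  all functions lies in `𝓗_0` with `C_n = 1` (Jensen `|∫ F dμ| ≤ (∫ F² dμ)^{1/2}`).

## Design notes

* Imports (rebased 2026-08-15, request `defn-InfiniteChainInvariantStates`): the vocabulary
  `IsLocalTestFunction`, `liouvilleZ P`, `shift`, `IsShiftInvariant`, `IsTimeInvariant P`,
  `boxRestrictAt`, `partialQZ/PZ` is the fact-free
  `Literature.MathematicalPhysics.KineticTheory.InfiniteChainInvariantStates` (same namespace as this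
  file, chain `P` an explicit first argument), reached through `InfiniteChainObservables` (whose
  `IsLocalTestFunction.comp_shift` is used); the first version (p46367) imported the barrier entry
  `Literature/Barriers/AtomisticToContinuum/MacroErgodicityHypothesis.lean` for the same notions and
  thereby carried the OPEN `MacroErgodicityHypothesis` in its cone. The barrier entry keeps the old
  names as reducible aliases of the same declarations, so the route items `PlaneLiouville` /
  `SlopeCurrentLaw`, which spell the old names, still restate by `isStationaryPerturbation_one_iff`
  up to that unfolding.
* `ν` is a plain function with linearity as clause (a), exactly as the route items quantify;
  clause (c) keeps the route's `Real.sqrt (∫ (g ∘ box)² dμ)` and its `Integrable ((g ∘ box)²) μ`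
  guard; `C_n` is not required to be `≥ 0` (rescaling lemmas use `max C_n 0`).
* No Gibbs / probability / translation-invariance hypothesis is built in: `μ` is a parameter and
  each lemma carries what it uses.
* NOT here: the half-line classes `𝓗_k(ℕ, bath)` (companion request D2, another generator), the
  temperature-shift functional `ν_sh` and the McLennan state (need covariance-summability facts not
  in the tree), and "Gibbs ⇒ `IsTimeInvariant`" (DLR integration by parts, not attempted).
-/

noncomputable section

open MeasureTheory ProbabilityTheory Filter Set

namespace Literature.MathematicalPhysics.KineticTheory.HeatConduction

/-! ### The predicate -/

/-- **Stationary first-order perturbation of growth order `k`** of the reference measure `μ` for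
the infinite chain `P`: a functional `ν` on observables `ChainConfig → ℝ` which is (a) `ℝ`-linear,
(b) stationary to first order — `ν (𝒜f) = 0` for every local test function `f ∈ C₀¹`, `𝒜 =
liouvilleZ P` — and (c) of polynomial growth of order `k` in `L²(μ)` on `C¹` functions of boxes:
for every box length `n` there is `C_n` with
`|ν (g ∘ boxRestrictAt a n)| ≤ C_n (1 + |a|)^k (∫ (g ∘ boxRestrictAt a n)² dμ)^{1/2}` for all `a : ℤ`
and all `C¹` maps `g` with `g ∘ boxRestrictAt a n` square-integrable. `k = 1`: the hypothesis block
of route LiouvilleLadder's `PlaneLiouville` / `SlopeCurrentLaw`; `k = 0`: bounded perturbations.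
(Route-posited notion, request `defn-StationaryPerturbationClass`; clause (b) is the linearised
generator form of time invariance of Bernardin 2014 §1.1 Def. 1 footnote / McLennan 1959, clause (c)
the polynomial-growth grading of Avellaneda–Lin 1987 Liouville theorems; not a published
definition as such.) [folklore] -/
structure OscillatorChain.IsStationaryPerturbation (P : OscillatorChain) (μ : Measure ChainConfig)
    (k : ℕ) (ν : (ChainConfig → ℝ) → ℝ) : Prop where
  /-- (a) `ν` is `ℝ`-linear. -/
  linear : ∀ (f g : ChainConfig → ℝ) (a b : ℝ), ν (fun σ => a * f σ + b * g σ) = a * ν f + b * ν g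
  /-- (b) first-order stationarity `ν (𝒜f) = 0` on local test functions. -/
  stationary : ∀ f : ChainConfig → ℝ, IsLocalTestFunction f → ν (liouvilleZ P f) = 0
  /-- (c) growth of order `k` in `L²(μ)` on `C¹` functions of the boxes `{a, …, a+n}`. -/
  growth : ∀ n : ℕ, ∃ C : ℝ, ∀ (a : ℤ) (g : (Fin (n + 1) → ℝ × ℝ) → ℝ), ContDiff ℝ 1 g →
    Integrable (fun σ => (g (boxRestrictAt a n σ)) ^ 2) μ →
      |ν (g ∘ boxRestrictAt a n)| ≤
        C * (1 + |(a : ℝ)|) ^ k * Real.sqrt (∫ σ, (g (boxRestrictAt a n σ)) ^ 2 ∂μ)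

variable {P : OscillatorChain} {μ : Measure ChainConfig} {k : ℕ} {ν ν₁ ν₂ : (ChainConfig → ℝ) → ℝ}

/-- Unfolding the predicate into its three clauses. [folklore] -/
theorem OscillatorChain.isStationaryPerturbation_iff (P : OscillatorChain) (μ : Measure ChainConfig)
    (k : ℕ) (ν : (ChainConfig → ℝ) → ℝ) :
    P.IsStationaryPerturbation μ k ν ↔
      (∀ (f g : ChainConfig → ℝ) (a b : ℝ), ν (fun σ => a * f σ + b * g σ) = a * ν f + b * ν g) ∧
      (∀ f : ChainConfig → ℝ, IsLocalTestFunction f → ν (liouvilleZ P f) = 0) ∧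
      (∀ n : ℕ, ∃ C : ℝ, ∀ (a : ℤ) (g : (Fin (n + 1) → ℝ × ℝ) → ℝ), ContDiff ℝ 1 g →
        Integrable (fun σ => (g (boxRestrictAt a n σ)) ^ 2) μ →
          |ν (g ∘ boxRestrictAt a n)| ≤
            C * (1 + |(a : ℝ)|) ^ k * Real.sqrt (∫ σ, (g (boxRestrictAt a n σ)) ^ 2 ∂μ)) :=
  ⟨fun h => ⟨h.linear, h.stationary, h.growth⟩, fun h => ⟨h.1, h.2.1, h.2.2⟩⟩

/-- The linear-growth class `𝓗_1`: word for word the hypothesis block of `PlaneLiouville` /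
`SlopeCurrentLaw` (growth factor `C * (1 + |a|)`). [folklore] -/
theorem OscillatorChain.isStationaryPerturbation_one_iff (P : OscillatorChain)
    (μ : Measure ChainConfig) (ν : (ChainConfig → ℝ) → ℝ) :
    P.IsStationaryPerturbation μ 1 ν ↔
      (∀ (f g : ChainConfig → ℝ) (a b : ℝ), ν (fun σ => a * f σ + b * g σ) = a * ν f + b * ν g) ∧
      (∀ f : ChainConfig → ℝ, IsLocalTestFunction f → ν (liouvilleZ P f) = 0) ∧
      (∀ n : ℕ, ∃ C : ℝ, ∀ (a : ℤ) (g : (Fin (n + 1) → ℝ × ℝ) → ℝ), ContDiff ℝ 1 g →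
        Integrable (fun σ => (g (boxRestrictAt a n σ)) ^ 2) μ →
          |ν (g ∘ boxRestrictAt a n)| ≤
            C * (1 + |(a : ℝ)|) * Real.sqrt (∫ σ, (g (boxRestrictAt a n σ)) ^ 2 ∂μ)) := by
  simp only [OscillatorChain.isStationaryPerturbation_iff, pow_one]

/-- The bounded class `𝓗_0`: no growth factor. [folklore] -/
theorem OscillatorChain.isStationaryPerturbation_zero_iff (P : OscillatorChain)
    (μ : Measure ChainConfig) (ν : (ChainConfig → ℝ) → ℝ) :
    P.IsStationaryPerturbation μ 0 ν ↔
      (∀ (f g : ChainConfig → ℝ) (a b : ℝ), ν (fun σ => a * f σ + b * g σ) = a * ν f + b * ν g) ∧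
      (∀ f : ChainConfig → ℝ, IsLocalTestFunction f → ν (liouvilleZ P f) = 0) ∧
      (∀ n : ℕ, ∃ C : ℝ, ∀ (a : ℤ) (g : (Fin (n + 1) → ℝ × ℝ) → ℝ), ContDiff ℝ 1 g →
        Integrable (fun σ => (g (boxRestrictAt a n σ)) ^ 2) μ →
          |ν (g ∘ boxRestrictAt a n)| ≤ C * Real.sqrt (∫ σ, (g (boxRestrictAt a n σ)) ^ 2 ∂μ)) := by
  simp only [OscillatorChain.isStationaryPerturbation_iff, pow_zero, mul_one]

/-! ### Linearity API -/

/-- A bundled linear map satisfies clause (a). [folklore] -/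
theorem linear_of_linearMap (L : (ChainConfig → ℝ) →ₗ[ℝ] ℝ) (f g : ChainConfig → ℝ) (a b : ℝ) :
    L (fun σ => a * f σ + b * g σ) = a * L f + b * L g := by
  have : (fun σ => a * f σ + b * g σ) = a • f + b • g := by
    funext σ; simp [smul_eq_mul]
  rw [this, map_add, map_smul, map_smul, smul_eq_mul, smul_eq_mul]

/-- Clause (a) bundles `ν` into an `ℝ`-linear map. [folklore] -/
def OscillatorChain.IsStationaryPerturbation.toLinearMap (h : P.IsStationaryPerturbation μ k ν) :
    (ChainConfig → ℝ) →ₗ[ℝ] ℝ where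
  toFun := ν
  map_add' f g := by
    have hfg : f + g = fun σ => (1 : ℝ) * f σ + 1 * g σ := by funext σ; simp
    rw [hfg, h.linear, one_mul, one_mul]
  map_smul' c f := by
    have hcf : c • f = fun σ => c * f σ + 0 * f σ := by funext σ; simp [smul_eq_mul]
    rw [hcf, h.linear, RingHom.id_apply, smul_eq_mul, zero_mul, add_zero]

/-- `toLinearMap` is `ν`. [folklore] -/
@[simp] theorem OscillatorChain.IsStationaryPerturbation.toLinearMap_apply
    (h : P.IsStationaryPerturbation μ k ν) (f : ChainConfig → ℝ) : h.toLinearMap f = ν f := rfl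

/-- Additivity of a stationary perturbation. [folklore] -/
theorem OscillatorChain.IsStationaryPerturbation.map_add (h : P.IsStationaryPerturbation μ k ν)
    (f g : ChainConfig → ℝ) : ν (f + g) = ν f + ν g :=
  h.toLinearMap.map_add f g

/-- Homogeneity of a stationary perturbation. [folklore] -/
theorem OscillatorChain.IsStationaryPerturbation.map_smul (h : P.IsStationaryPerturbation μ k ν)
    (c : ℝ) (f : ChainConfig → ℝ) : ν (c • f) = c * ν f :=
  h.toLinearMap.map_smul c f

/-- A stationary perturbation vanishes on `0`. [folklore] -/
theorem OscillatorChain.IsStationaryPerturbation.map_zero (h : P.IsStationaryPerturbation μ k ν) :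
    ν 0 = 0 :=
  h.toLinearMap.map_zero

/-- A stationary perturbation is odd. [folklore] -/
theorem OscillatorChain.IsStationaryPerturbation.map_neg (h : P.IsStationaryPerturbation μ k ν)
    (f : ChainConfig → ℝ) : ν (-f) = -ν f :=
  h.toLinearMap.map_neg f

/-- A stationary perturbation is subtractive. [folklore] -/
theorem OscillatorChain.IsStationaryPerturbation.map_sub (h : P.IsStationaryPerturbation μ k ν)
    (f g : ChainConfig → ℝ) : ν (f - g) = ν f - ν g :=
  h.toLinearMap.map_sub f g

/-! ### The classes `𝓗_k` are linear spaces, increasing in `k` -/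

/-- `0 ∈ 𝓗_k`. [folklore] -/
theorem OscillatorChain.IsStationaryPerturbation.zero (P : OscillatorChain) (μ : Measure ChainConfig)
    (k : ℕ) : P.IsStationaryPerturbation μ k 0 where
  linear f g a b := by simp
  stationary _ _ := rfl
  growth n := ⟨0, fun a g _ _ => by simp⟩

/-- `𝓗_k` is closed under addition. [folklore] -/
theorem OscillatorChain.IsStationaryPerturbation.add (h₁ : P.IsStationaryPerturbation μ k ν₁)
    (h₂ : P.IsStationaryPerturbation μ k ν₂) : P.IsStationaryPerturbation μ k (ν₁ + ν₂) where
  linear f g a b := by simp only [Pi.add_apply, h₁.linear, h₂.linear]; ring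
  stationary f hf := by simp only [Pi.add_apply, h₁.stationary f hf, h₂.stationary f hf, add_zero]
  growth n := by
    obtain ⟨C₁, hC₁⟩ := h₁.growth n
    obtain ⟨C₂, hC₂⟩ := h₂.growth n
    refine ⟨C₁ + C₂, fun a g hg hint => ?_⟩
    have e₁ := hC₁ a g hg hint
    have e₂ := hC₂ a g hg hint
    simp only [Pi.add_apply]
    calc |ν₁ (g ∘ boxRestrictAt a n) + ν₂ (g ∘ boxRestrictAt a n)|
        ≤ |ν₁ (g ∘ boxRestrictAt a n)| + |ν₂ (g ∘ boxRestrictAt a n)| := abs_add_le _ _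
      _ ≤ _ := add_le_add e₁ e₂
      _ = (C₁ + C₂) * (1 + |(a : ℝ)|) ^ k * Real.sqrt (∫ σ, (g (boxRestrictAt a n σ)) ^ 2 ∂μ) := by
          ring

/-- `𝓗_k` is closed under scalar multiplication. [folklore] -/
theorem OscillatorChain.IsStationaryPerturbation.smul (h : P.IsStationaryPerturbation μ k ν) (c : ℝ) :
    P.IsStationaryPerturbation μ k (c • ν) where
  linear f g a b := by simp only [Pi.smul_apply, smul_eq_mul, h.linear]; ring
  stationary f hf := by simp only [Pi.smul_apply, smul_eq_mul, h.stationary f hf, mul_zero]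
  growth n := by
    obtain ⟨C, hC⟩ := h.growth n
    refine ⟨|c| * C, fun a g hg hint => ?_⟩
    have e := hC a g hg hint
    simp only [Pi.smul_apply, smul_eq_mul, abs_mul]
    calc |c| * |ν (g ∘ boxRestrictAt a n)|
        ≤ |c| * (C * (1 + |(a : ℝ)|) ^ k * Real.sqrt (∫ σ, (g (boxRestrictAt a n σ)) ^ 2 ∂μ)) :=
          mul_le_mul_of_nonneg_left e (abs_nonneg c)
      _ = |c| * C * (1 + |(a : ℝ)|) ^ k * Real.sqrt (∫ σ, (g (boxRestrictAt a n σ)) ^ 2 ∂μ) := by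
          ring

/-- **The class `𝓗_k(ℤ)`** of stationary first-order perturbations of `μ` of growth order `k`, as an
`ℝ`-submodule of the functionals on observables ("closure under linear combinations"). [folklore] -/
def OscillatorChain.StationaryPerturbationClass (P : OscillatorChain) (μ : Measure ChainConfig)
    (k : ℕ) : Submodule ℝ ((ChainConfig → ℝ) → ℝ) where
  carrier := {ν | P.IsStationaryPerturbation μ k ν}
  add_mem' h₁ h₂ := h₁.add h₂
  zero_mem' := OscillatorChain.IsStationaryPerturbation.zero P μ k
  smul_mem' c _ h := h.smul c

/-- Membership in `𝓗_k`. [folklore] -/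
@[simp] theorem OscillatorChain.mem_stationaryPerturbationClass_iff :
    ν ∈ P.StationaryPerturbationClass μ k ↔ P.IsStationaryPerturbation μ k ν := Iff.rfl

/-- `𝓗_k` is closed under negation. [folklore] -/
theorem OscillatorChain.IsStationaryPerturbation.neg (h : P.IsStationaryPerturbation μ k ν) :
    P.IsStationaryPerturbation μ k (-ν) :=
  (P.StationaryPerturbationClass μ k).neg_mem h

/-- `𝓗_k` is closed under subtraction. [folklore] -/
theorem OscillatorChain.IsStationaryPerturbation.sub (h₁ : P.IsStationaryPerturbation μ k ν₁)
    (h₂ : P.IsStationaryPerturbation μ k ν₂) : P.IsStationaryPerturbation μ k (ν₁ - ν₂) :=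
  (P.StationaryPerturbationClass μ k).sub_mem h₁ h₂

/-- Rescaling a growth constant: `C (1+|a|)^k S ≤ (max C 0) (1+|a|)^l S` for `k ≤ l`, `S ≥ 0`.
[folklore] -/
theorem growthConst_mono (C : ℝ) (a : ℤ) {k l : ℕ} (hkl : k ≤ l) {S : ℝ} (hS : 0 ≤ S) :
    C * (1 + |(a : ℝ)|) ^ k * S ≤ max C 0 * (1 + |(a : ℝ)|) ^ l * S := by
  have h1 : (1 : ℝ) ≤ 1 + |(a : ℝ)| := le_add_of_nonneg_right (abs_nonneg _)
  have h0 : (0 : ℝ) ≤ (1 + |(a : ℝ)|) ^ k := pow_nonneg (zero_le_one.trans h1) _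
  calc C * (1 + |(a : ℝ)|) ^ k * S ≤ max C 0 * (1 + |(a : ℝ)|) ^ k * S :=
        mul_le_mul_of_nonneg_right (mul_le_mul_of_nonneg_right (le_max_left C 0) h0) hS
    _ ≤ max C 0 * (1 + |(a : ℝ)|) ^ l * S :=
        mul_le_mul_of_nonneg_right
          (mul_le_mul_of_nonneg_left (pow_le_pow_right₀ h1 hkl) (le_max_right C 0)) hS

/-- The classes increase with the growth order: `𝓗_k ⊆ 𝓗_l` for `k ≤ l`. [folklore] -/
theorem OscillatorChain.IsStationaryPerturbation.mono (h : P.IsStationaryPerturbation μ k ν) {l : ℕ}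
    (hkl : k ≤ l) : P.IsStationaryPerturbation μ l ν where
  linear := h.linear
  stationary := h.stationary
  growth n := by
    obtain ⟨C, hC⟩ := h.growth n
    exact ⟨max C 0, fun a g hg hint =>
      (hC a g hg hint).trans (growthConst_mono C a hkl (Real.sqrt_nonneg _))⟩

/-- `𝓗_k ≤ 𝓗_l` as submodules, `k ≤ l`. [folklore] -/
theorem OscillatorChain.stationaryPerturbationClass_mono (P : OscillatorChain) (μ : Measure ChainConfig)
    {k l : ℕ} (hkl : k ≤ l) : P.StationaryPerturbationClass μ k ≤ P.StationaryPerturbationClass μ l :=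
  fun _ h => h.mono hkl

/-! ### `L²(μ)`-continuity on `C¹` functions of a box -/

/-- From (a)+(c): on `C¹` functions of the box `{a, …, a+n}` a stationary perturbation of growth
order `k` is `L²(μ)`-Lipschitz with constant `C_n (1 + |a|)^k`:
`|ν (g₁ ∘ box) - ν (g₂ ∘ box)| ≤ C_n (1+|a|)^k ‖(g₁ - g₂) ∘ box‖_{L²(μ)}`. [folklore] -/
theorem OscillatorChain.IsStationaryPerturbation.abs_sub_le (h : P.IsStationaryPerturbation μ k ν)
    (n : ℕ) : ∃ C : ℝ, ∀ (a : ℤ) (g₁ g₂ : (Fin (n + 1) → ℝ × ℝ) → ℝ), ContDiff ℝ 1 g₁ → ContDiff ℝ 1 g₂ →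
      Integrable (fun σ => (g₁ (boxRestrictAt a n σ) - g₂ (boxRestrictAt a n σ)) ^ 2) μ →
        |ν (g₁ ∘ boxRestrictAt a n) - ν (g₂ ∘ boxRestrictAt a n)| ≤
          C * (1 + |(a : ℝ)|) ^ k *
            Real.sqrt (∫ σ, (g₁ (boxRestrictAt a n σ) - g₂ (boxRestrictAt a n σ)) ^ 2 ∂μ) := by
  obtain ⟨C, hC⟩ := h.growth n
  refine ⟨C, fun a g₁ g₂ hg₁ hg₂ hint => ?_⟩
  have key := hC a (g₁ - g₂) (hg₁.sub hg₂) (by simpa only [Pi.sub_apply] using hint)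
  have hsub : ν ((g₁ - g₂) ∘ boxRestrictAt a n) = ν (g₁ ∘ boxRestrictAt a n) - ν (g₂ ∘ boxRestrictAt a n) := by
    rw [← h.map_sub]; rfl
  simpa only [hsub, Function.comp_apply, Pi.sub_apply] using key

/-! ### The spatial shift

Measurability of `shift` / `boxRestrictAt`, the measurable equivalence `shiftEquiv`, the change of
variables `IsShiftInvariant.integral_comp_shift` / `.integrable_comp_shift_iff`, the covariance
`force_shift`, `liouvilleZ_comp_shift` (pointwise) and the closure `IsLocalTestFunction.comp_shift`
are those of `InfiniteChainObservables`; only what that module does not state is added here. -/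

/-- `(τσ)_x = σ_{x+1}`. [folklore] -/
theorem shift_apply (σ : ChainConfig) (x : ℤ) : shift σ x = σ (x + 1) := rfl

/-- A translation invariant `μ` is preserved by the shift. [folklore] -/
theorem measurePreserving_shift (hμ : IsShiftInvariant μ) : MeasurePreserving shift μ μ :=
  ⟨shift_measurable, hμ⟩

/-- Shifting a box: `boxRestrictAt a n (τσ) = boxRestrictAt (a+1) n σ`. [folklore] -/
theorem boxRestrictAt_shift (a : ℤ) (n : ℕ) (σ : ChainConfig) :
    boxRestrictAt a n (shift σ) = boxRestrictAt (a + 1) n σ := by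
  funext i
  simp only [boxRestrictAt, shift]
  congr 1
  ring

/-- **The Liouville operator commutes with the shift**, as an identity of functions:
`𝒜(f ∘ τ) = (𝒜f) ∘ τ` (pointwise: `liouvilleZ_comp_shift` of `InfiniteChainObservables`). [folklore] -/
theorem OscillatorChain.liouvilleZ_comp_shift (P : OscillatorChain) (f : ChainConfig → ℝ) :
    liouvilleZ P (f ∘ shift) = liouvilleZ P f ∘ shift :=
  funext fun σ =>
    _root_.Literature.MathematicalPhysics.KineticTheory.HeatConduction.liouvilleZ_comp_shift P f σ

/-- Rescaling a growth constant across one shift: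
`C (1+|a+1|)^k S ≤ (max C 0) 2^k (1+|a|)^k S` for `S ≥ 0`. [folklore] -/
theorem growthConst_shift (C : ℝ) (a : ℤ) (k : ℕ) {S : ℝ} (hS : 0 ≤ S) :
    C * (1 + |((a + 1 : ℤ) : ℝ)|) ^ k * S ≤ max C 0 * 2 ^ k * (1 + |(a : ℝ)|) ^ k * S := by
  have h1 : (0 : ℝ) ≤ 1 + |((a + 1 : ℤ) : ℝ)| := by positivity
  have h2 : 1 + |((a + 1 : ℤ) : ℝ)| ≤ 2 * (1 + |(a : ℝ)|) := by
    push_cast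
    have := abs_add_le (a : ℝ) 1
    rw [abs_one] at this
    linarith [abs_nonneg (a : ℝ)]
  calc C * (1 + |((a + 1 : ℤ) : ℝ)|) ^ k * S
      ≤ max C 0 * (1 + |((a + 1 : ℤ) : ℝ)|) ^ k * S :=
        mul_le_mul_of_nonneg_right (mul_le_mul_of_nonneg_right (le_max_left _ _) (pow_nonneg h1 _)) hS
    _ ≤ max C 0 * (2 * (1 + |(a : ℝ)|)) ^ k * S :=
        mul_le_mul_of_nonneg_right
          (mul_le_mul_of_nonneg_left (pow_le_pow_left₀ h1 h2 k) (le_max_right _ _)) hS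
    _ = max C 0 * 2 ^ k * (1 + |(a : ℝ)|) ^ k * S := by rw [mul_pow]; ring

/-- **Closure of `𝓗_k` under the spatial shift.** For a translation invariant reference measure
`μ`, if `ν ∈ 𝓗_k` then `τ_* ν : f ↦ ν (f ∘ τ)` is again in `𝓗_k` (linearity is clear; stationarity
by `𝒜(f ∘ τ) = (𝒜f) ∘ τ` and shift invariance of `C₀¹`; growth with constant `max C_n 0 · 2^k`,
since `(g ∘ boxRestrictAt a n) ∘ τ = g ∘ boxRestrictAt (a+1) n`, `μ ∘ τ⁻¹ = μ` and
`1 + |a + 1| ≤ 2 (1 + |a|)`). [folklore] -/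
theorem OscillatorChain.IsStationaryPerturbation.comp_shift (hμ : IsShiftInvariant μ)
    (h : P.IsStationaryPerturbation μ k ν) :
    P.IsStationaryPerturbation μ k (fun f => ν (f ∘ shift)) where
  linear f g a b := h.linear (f ∘ shift) (g ∘ shift) a b
  stationary f hf := by
    show ν (liouvilleZ P f ∘ shift) = 0
    rw [← OscillatorChain.liouvilleZ_comp_shift P]
    exact h.stationary _ hf.comp_shift
  growth n := by
    obtain ⟨C, hC⟩ := h.growth n
    refine ⟨max C 0 * 2 ^ k, fun a g hg hint => ?_⟩
    have hfun : (g ∘ boxRestrictAt a n) ∘ shift = g ∘ boxRestrictAt (a + 1) n := by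
      funext σ; simp only [Function.comp_apply, boxRestrictAt_shift]
    have hint' : Integrable (fun σ => (g (boxRestrictAt (a + 1) n σ)) ^ 2) μ := by
      have h2 := (hμ.integrable_comp_shift_iff (fun σ => (g (boxRestrictAt a n σ)) ^ 2)).mpr hint
      simpa only [Function.comp_def, boxRestrictAt_shift] using h2
    have hI : ∫ σ, (g (boxRestrictAt (a + 1) n σ)) ^ 2 ∂μ = ∫ σ, (g (boxRestrictAt a n σ)) ^ 2 ∂μ := by
      simpa only [boxRestrictAt_shift] using
        hμ.integral_comp_shift (fun σ => (g (boxRestrictAt a n σ)) ^ 2)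
    have key := hC (a + 1) g hg hint'
    rw [hI] at key
    show |ν ((g ∘ boxRestrictAt a n) ∘ shift)| ≤ _
    rw [hfun]
    exact key.trans (growthConst_shift C a k (Real.sqrt_nonneg _))

/-- The shift acts on each class `𝓗_k` (translation invariant `μ`) as a linear map. [folklore] -/
def OscillatorChain.stationaryPerturbationClassShift (P : OscillatorChain) (μ : Measure ChainConfig)
    (k : ℕ) (hμ : IsShiftInvariant μ) :
    P.StationaryPerturbationClass μ k →ₗ[ℝ] P.StationaryPerturbationClass μ k where
  toFun ν := ⟨fun f => (ν : (ChainConfig → ℝ) → ℝ) (f ∘ shift), ν.2.comp_shift hμ⟩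
  map_add' _ _ := rfl
  map_smul' _ _ := rfl

/-- The shift action, evaluated. [folklore] -/
@[simp] theorem OscillatorChain.stationaryPerturbationClassShift_apply (hμ : IsShiftInvariant μ)
    (ν : P.StationaryPerturbationClass μ k) (f : ChainConfig → ℝ) :
    (P.stationaryPerturbationClassShift μ k hμ ν : (ChainConfig → ℝ) → ℝ) f =
      (ν : (ChainConfig → ℝ) → ℝ) (f ∘ shift) := rfl

/-! ### Non-vacuity: the expectation functional is a bounded stationary perturbation -/

/-- The `ℝ`-submodule of `μ`-integrable real functions of the configuration. [folklore] -/
def integrableSubmodule (μ : Measure ChainConfig) : Submodule ℝ (ChainConfig → ℝ) where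
  carrier := {f | Integrable f μ}
  add_mem' hf hg := hf.add hg
  zero_mem' := integrable_zero ChainConfig ℝ μ
  smul_mem' c _ hf := hf.smul c

/-- Membership in `integrableSubmodule`. [folklore] -/
@[simp] theorem mem_integrableSubmodule_iff {f : ChainConfig → ℝ} :
    f ∈ integrableSubmodule μ ↔ Integrable f μ := Iff.rfl

/-- The expectation `f ↦ ∫ f dμ` as a linear map on the integrable functions. [folklore] -/
def integralLinearMap (μ : Measure ChainConfig) : integrableSubmodule μ →ₗ[ℝ] ℝ where
  toFun f := ∫ σ, (f : ChainConfig → ℝ) σ ∂μ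
  map_add' f g := by
    simpa only [Submodule.coe_add, Pi.add_apply] using integral_add f.2 g.2
  map_smul' c f := by
    simp only [Submodule.coe_smul, Pi.smul_apply, smul_eq_mul, RingHom.id_apply]
    exact integral_const_mul c _

/-- `integralLinearMap` is the integral. [folklore] -/
@[simp] theorem integralLinearMap_apply (f : integrableSubmodule μ) :
    integralLinearMap μ f = ∫ σ, (f : ChainConfig → ℝ) σ ∂μ := rfl

/-- Jensen / Cauchy–Schwarz on a probability space in the form used by clause (c) with `C = 1`:
`|∫ F dμ| ≤ (∫ F² dμ)^{1/2}` for square-integrable, a.e.-strongly measurable `F`. [folklore] -/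
theorem abs_integral_le_sqrt_integral_sq [IsProbabilityMeasure μ] {F : ChainConfig → ℝ}
    (hF : AEStronglyMeasurable F μ) (hint : Integrable (fun σ => (F σ) ^ 2) μ) :
    |∫ σ, F σ ∂μ| ≤ Real.sqrt (∫ σ, (F σ) ^ 2 ∂μ) := by
  have hL2 : MemLp F 2 μ := (memLp_two_iff_integrable_sq hF).mpr hint
  refine Real.abs_le_sqrt ?_
  have hvar := variance_nonneg F μ
  rw [variance_eq_sub hL2] at hvar
  simpa only [Pi.pow_apply, sub_nonneg] using hvar

/-- **`E_μ ∈ 𝓗_0`.** If `μ` is a probability measure on configurations, time invariant in the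
generator sense (`IsTimeInvariant P μ`: `𝒜f` integrable with `∫ 𝒜f dμ = 0` for `f ∈ C₀¹`), then
some `ν ∈ 𝓗_0` (growth constants `C_n = 1`) agrees with `f ↦ ∫ f dμ` on every `μ`-integrable `f`
— a linear extension of the expectation from `integrableSubmodule μ` to all functions
(`LinearMap.exists_extend`). In particular `ν 1 = 1`, so the classes `𝓗_k ⊇ 𝓗_0` are non-zero for
such `μ`. [folklore] -/
theorem OscillatorChain.exists_isStationaryPerturbation_integral (P : OscillatorChain)
    (μ : Measure ChainConfig) [IsProbabilityMeasure μ] (hμ : IsTimeInvariant P μ) :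
    ∃ ν : (ChainConfig → ℝ) → ℝ, P.IsStationaryPerturbation μ 0 ν ∧
      ∀ f : ChainConfig → ℝ, Integrable f μ → ν f = ∫ σ, f σ ∂μ := by
  obtain ⟨G, hG⟩ := LinearMap.exists_extend (integralLinearMap μ)
  have hGint : ∀ f : ChainConfig → ℝ, Integrable f μ → G f = ∫ σ, f σ ∂μ := fun f hf =>
    LinearMap.congr_fun hG ⟨f, hf⟩
  refine ⟨G, ⟨linear_of_linearMap G, fun f hf => ?_, fun n => ⟨1, fun a g hg hint => ?_⟩⟩, hGint⟩
  · obtain ⟨hint, h0⟩ := hμ f hf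
    rw [hGint _ hint, h0]
  · have hmeas : AEStronglyMeasurable (g ∘ boxRestrictAt a n) μ :=
      (hg.continuous.measurable.comp (boxRestrictAt_measurable a n)).aestronglyMeasurable
    have hL2 : MemLp (g ∘ boxRestrictAt a n) 2 μ := (memLp_two_iff_integrable_sq hmeas).mpr hint
    have hL1 : Integrable (g ∘ boxRestrictAt a n) μ := hL2.integrable one_le_two
    rw [hGint _ hL1, pow_zero, mul_one, one_mul]
    exact abs_integral_le_sqrt_integral_sq hmeas hint

end Literature.MathematicalPhysics.KineticTheory.HeatConduction
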